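import Summits.KontsevichZagierPeriods.KontsevichZagierPeriods.Theorems.RealEllipticSectorKernel.Negative.Ovals
import Summits.KontsevichZagierPeriods.KontsevichZagierPeriods.Theorems.RealEllipticSectorKernel.Negative.Lemniscatic
import Summits.KontsevichZagierPeriods.KontsevichZagierPeriods.Theorems.RealEllipticSectorKernel.Negative.GeneratorNotRelation
import Literature.NumberTheory.Transcendental.KZSubcalculusInvariants
import Summits.KontsevichZagierPeriods.KontsevichZagierPeriods.Theorems.GenusTwoCycleTransfer.Negative.Witnesses

/-!
# `RealEllipticSectorKernel` (stmt-KontsevichZagierPeriods-10632), negative side: the two-torsion element at `(4,0)`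

cdisprove finding F10 (commentary in `Cruxes/RealEllipticSectorKernel/Disproof.lean` §10). At the
model curve `y² = 4x³ − 4x` the 2-torsion translation by `(0,0)` is the RATIONAL map `x ↦ −1/x`,
carrying `σ'' = (1,∞)` onto `σ = (−1,0)` with Jacobian weight exactly `1/√f`. The two-torsion element
`t₀ = [σ'',1/√f] − [σ,1/√f]` (`twoTorsionElem`, honest representations `genIoi`, `genσ40`) has
`eval = 0` (`eval_twoTorsionElem`, elementary: reflection + inversion, `Negative/Lemniscatic.lean`),
is NOT in the subgroup generated by the additivity moves (`twoTorsionElem_not_mem_closure_add`,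
window `{x > 1}`), and IS literally one `KZ.changeOfVariablesRel` instance
(`twoTorsionElem_mem_cov`: semialgebraic map, `HasFDerivWithinAt`, injectivity, exact image, exact
weight on the UNBOUNDED domain — the planner's "why it might fail" for `TwoTorsionTransfer`,
discharged in the tree's own format); `twoTorsionTransfer_four_zero` is the `(4,0)` instance of the
support item `TwoTorsionTransfer` (3413) for arbitrary presentations.

Sources: M. Kontsevich, D. Zagier, *Periods* (2001), §§1.1–1.2; J. H. Silverman, *Advanced Topics in
the Arithmetic of Elliptic Curves* (1994), II.2 (translation by 2-torsion as a rational map). -/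

noncomputable section

namespace Summit.KontsevichZagierPeriods.RealEllipticSectorKernel.TwoTorsionElement

open MeasureTheory Set
open Literature.NumberTheory.Transcendental Literature.ModelTheory.ExponentialFields
open Summit.KontsevichZagierPeriods.RealEllipticSectorKernel.Negative
open Summit.KontsevichZagierPeriods.RealEllipticSectorKernel.Ovals
open Summit.KontsevichZagierPeriods.HermiteRigidity.GenusTwoCycleTransferNegative (setIntegral_fin_one)
open Summit.KontsevichZagierPeriods.RealEllipticSectorKernel.GeneratorNotRelation (isSemialgebraic_Ioi_one)
/-! ### The third-family generator at `(4,0)` (from `GeneratorNotRelation`) -/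

/-- `σ'' = (1, ∞)` at `(4,0)`. [folklore] -/
theorem σ₃_four_zero : σ₃ 4 0 = {p | 1 < p 0} :=
  Summit.KontsevichZagierPeriods.RealEllipticSectorKernel.GeneratorNotRelation.sigma''_four_zero

/-- The generator `[(1,∞), 1/√(4x³ − 4x)]` as an honest representation. [cite: KontsevichZagier2001, §1.1] -/
def genIoi : KZ.IntegralRep 1 where
  domain := {p | 1 < p 0}
  integrand := fun p => 1 / Real.sqrt (cubic 4 0 (p 0))
  isSemialgebraic_domain := isSemialgebraic_Ioi_one
  isSemialgebraicFunOn_integrand :=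
    Summit.KontsevichZagierPeriods.RealEllipticSectorKernel.GeneratorNotRelation.integrand_semialgebraic
  integrableOn :=
    Summit.KontsevichZagierPeriods.RealEllipticSectorKernel.GeneratorNotRelation.integrableOn_integrand

/-- Its value `Γ(1/4)²/(4√(2π))`. [cite: NesterenkoPhilippon2001, Ch. 1 §3 Remark ii] -/
theorem genIoi_value : genIoi.value = Real.Gamma (1 / 4) ^ 2 / (4 * Real.sqrt (2 * Real.pi)) :=
  Summit.KontsevichZagierPeriods.RealEllipticSectorKernel.GeneratorNotRelation.setIntegral_Ioi_one_eq

/-- `genIoi` is a generator of the `(4,0)`-sector. [folklore] -/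
theorem genIoi_mem_gens : KZ.of genIoi ∈ Gens 4 0 := by
  refine Or.inr ⟨genIoi, ?_, fun p _ => rfl, rfl⟩
  rw [σ₃_four_zero]; rfl

/-! ### §10 (F10, cycle 2) The two-torsion element at the model curve `(4,0)`:
honest, not a scissors congruence, and ONE legal rule-2 move

At `(q₂,q₃) = (4,0)` (`f = 4x³ − 4x`, roots `−1, 0, 1`) the 2-torsion translation by `(e₂,0) = (0,0)`
is the RATIONAL map `x ↦ −1/x`, carrying `σ'' = (1,∞)` onto `σ = (−1,0)` with
`f(−1/x)·x⁻⁴ = f(x)… ` i.e. weight `|d(−1/x)/dx|/√f(−1/x) = 1/√f(x)`. Hence: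
`t₀ = [σ'', 1/√f] − [σ, 1/√f]` is an honest kernel element (`eval_twoTorsionElem`), it is NOT in
the subgroup generated by the additivity moves (`twoTorsionElem_not_mem_closure_add`, window
`{x > 1}`), and it IS a single `changeOfVariablesRel` instance (`twoTorsionElem_mem_cov`: the
planner's "why it might fail" — rule 2's side conditions on the UNBOUNDED domain `(e₁,∞)`:
`ℚ`-semialgebraic map, `HasFDerivWithinAt`, injectivity, exact image, exact Jacobian weight — all
discharged in the tree's own `KZ.changeOfVariablesRel` format). `twoTorsionTransfer_four_zero` is
the `(4,0)` instance of the support item `TwoTorsionTransfer` (3413), PROVED (positive control; the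
general curve needs the cubic-irrational `eᵢ`, i.e. Tarski–Seidenberg for the graph, nothing else). -/

/-- `σ = (−1, 0)` at `(4,0)`. [folklore] -/
theorem σ₁_four_zero : σ₁ 4 0 = {p | -1 < p 0 ∧ p 0 < 0} := by
  ext p
  simp only [σ₁, cubic, mem_setOf_eq, Rat.cast_ofNat, Rat.cast_zero, sub_zero]
  constructor
  · rintro ⟨h0, t, hpt, ht⟩
    -- `f t < 0 ⇒ t < 1`; `f x > 0 ∧ x < 1 ⇒ -1 < x < 0`
    have ht1 : t < 1 := by
      by_contra h; push Not at h
      nlinarith [mul_nonneg (mul_nonneg (by linarith : (0:ℝ) ≤ t) (by linarith : (0:ℝ) ≤ t - 1))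
        (by linarith : (0:ℝ) ≤ t + 1)]
    have hx1 : p 0 < 1 := hpt.trans ht1
    have key : 0 < p 0 * (p 0 - 1) * (p 0 + 1) := by nlinarith
    constructor
    · by_contra h; push Not at h
      have : p 0 * (p 0 - 1) * (p 0 + 1) ≤ 0 :=
        mul_nonpos_of_nonneg_of_nonpos (mul_nonneg_of_nonpos_of_nonpos (by linarith) (by linarith))
          (by linarith)
      linarith
    · by_contra h; push Not at h
      have : p 0 * (p 0 - 1) * (p 0 + 1) ≤ 0 :=
        mul_nonpos_of_nonpos_of_nonneg (mul_nonpos_of_nonneg_of_nonpos h (by linarith)) (by linarith)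
      linarith
  · rintro ⟨h1, h0⟩
    refine ⟨by nlinarith [mul_pos (neg_pos.mpr h0) (by nlinarith : (0:ℝ) < 1 - p 0 ^ 2)],
      1 / 2, by linarith, by norm_num⟩

/-- `∫_{(−1,0)} dx/√(4x³ − 4x) = Γ(1/4)²/(4√(2π))` over `ℝ¹` (reflection + inversion from the
`(1,∞)` value; `CM66.integral_gI_Ioo_neg`). [folklore] -/
theorem setIntegral_Ioo_neg_one_zero_eq :
    ∫ p in {p : Fin 1 → ℝ | -1 < p 0 ∧ p 0 < 0}, 1 / Real.sqrt (cubic 4 0 (p 0)) = CM66.lemHalf := by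
  have h := setIntegral_fin_one (fun x => 1 / Real.sqrt (cubic 4 0 x)) (Ioo (-1) 0)
  simp only [mem_Ioo] at h
  rw [h, ← CM66.integral_gI_Ioo_neg]
  refine integral_congr_ae (Filter.Eventually.of_forall fun x => ?_)
  simp only [cubic, CM66.gI, Rat.cast_ofNat, Rat.cast_zero, sub_zero, one_div]

/-- The generator `[σ, 1/√(4x³−4x)]`, `σ = (−1,0)`, as an honest representation. [folklore] -/
def genσ40 : KZ.IntegralRep 1 where
  domain := σ₁ 4 0
  integrand := fun p => 1 / Real.sqrt (cubic 4 0 (p 0))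
  isSemialgebraic_domain := isSemialgebraic_σ₁ 4 0
  isSemialgebraicFunOn_integrand := isSemialgebraicFunOn_inv_sqrt_cubic 4 0
  integrableOn := by
    rw [σ₁_four_zero]
    by_contra h
    have h0 := integral_undef h
    rw [setIntegral_Ioo_neg_one_zero_eq] at h0
    exact absurd h0 (ne_of_gt CM66.lemHalf_pos)

/-- Auxiliary step of the isogeny / two-torsion computation (F9–F10). [folklore] -/
theorem genσ40_value : genσ40.value = CM66.lemHalf := by
  show ∫ p in σ₁ 4 0, 1 / Real.sqrt (cubic 4 0 (p 0)) = _
  rw [σ₁_four_zero, setIntegral_Ioo_neg_one_zero_eq]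

/-- Auxiliary step of the isogeny / two-torsion computation (F9–F10). [folklore] -/
theorem genIoi_value' : genIoi.value = CM66.lemHalf := genIoi_value

/-- Auxiliary step of the isogeny / two-torsion computation (F9–F10). [folklore] -/
theorem genσ40_mem_gens : KZ.of genσ40 ∈ Gens 4 0 :=
  Or.inl (Or.inl ⟨genσ40, 0, rfl, fun p _ => by simp [genσ40], rfl⟩)

/-- **The two-torsion element** `t₀ = [σ'', 1/√f] − [σ, 1/√f]` at `(4,0)`. [folklore] -/
def twoTorsionElem : KZ.FormalRep := KZ.of genIoi - KZ.of genσ40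

/-- Auxiliary step of the isogeny / two-torsion computation (F9–F10). [folklore] -/
theorem twoTorsionElem_mem_closure : twoTorsionElem ∈ AddSubgroup.closure (Gens 4 0) :=
  sub_mem (AddSubgroup.subset_closure genIoi_mem_gens) (AddSubgroup.subset_closure genσ40_mem_gens)

/-- **(F10)** `eval t₀ = 0` — the VALUE form of the two-torsion coincidence, here elementary
(no AGM, no `℘`). [folklore] -/
theorem eval_twoTorsionElem : KZ.eval twoTorsionElem = 0 := by
  simp [twoTorsionElem, map_sub, KZ.eval_of, genIoi_value', genσ40_value]

/-- `coeffSum t₀ = 0`: consistent with `t₀` being ONE rule-2 move (it is: `twoTorsionElem_mem_cov`). [folklore] -/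
theorem coeffSum_twoTorsionElem : KZ.coeffSum twoTorsionElem = 0 := by
  simp [twoTorsionElem]

/-- **(F10)** `t₀` is NOT in the subgroup generated by the additivity moves (1a) + (1b): its
restricted value over the window `{x > 1}` is the full lemniscatic half-period. Every derivation of
the two-torsion coincidence uses a change of variables or a Newton–Leibniz move. [folklore] -/
theorem twoTorsionElem_not_mem_closure_add :
    twoTorsionElem ∉ AddSubgroup.closure (KZ.domainAddRel ∪ KZ.integrandAddRel) := by
  intro h
  set A : (n : ℕ) → Set (Fin n → ℝ) := fun n => {p | ∀ i, 1 < p i} with hA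
  have hAm : ∀ n, MeasurableSet (A n) := by
    intro n
    have : A n = ⋂ i, {p : Fin n → ℝ | 1 < p i} := by ext p; simp [hA]
    rw [this]
    exact MeasurableSet.iInter fun i => measurableSet_lt measurable_const (measurable_pi_apply i)
  have h0 := KZ.closure_add_le_ker_restrictedEval A hAm h
  rw [AddMonoidHom.mem_ker] at h0
  have h1 : genIoi.domain ∩ A 1 = genIoi.domain := by
    refine inter_eq_left.mpr fun p hp i => ?_
    rw [Fin.fin_one_eq_zero i]; exact hp
  have h2 : genσ40.domain ∩ A 1 = ∅ := by
    ext p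
    simp only [mem_inter_iff, mem_empty_iff_false, iff_false, not_and]
    intro hp hA1
    have hp' : p ∈ σ₁ 4 0 := hp
    rw [σ₁_four_zero] at hp'
    linarith [hA1 0, hp'.2]
  simp only [twoTorsionElem, map_sub, KZ.restrictedEval_of, h1, h2, Measure.restrict_empty,
    integral_zero_measure, sub_zero] at h0
  have h3 : genIoi.value = 0 := h0
  rw [genIoi_value'] at h3
  exact absurd h3 (ne_of_gt CM66.lemHalf_pos)

/-! #### Positive control: `t₀` is ONE change-of-variables move -/

/-- The two-torsion translation at `(4,0)`: `x ↦ −1/x` on `ℝ¹`. [folklore] -/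
def invMap (p : Fin 1 → ℝ) : Fin 1 → ℝ := fun _ => -(p 0)⁻¹

/-- Its derivative `x⁻² • id`. [folklore] -/
def invMapDeriv (p : Fin 1 → ℝ) : (Fin 1 → ℝ) →L[ℝ] (Fin 1 → ℝ) :=
  ((p 0) ^ 2)⁻¹ • ContinuousLinearMap.id ℝ (Fin 1 → ℝ)

/-- Auxiliary step of the isogeny / two-torsion computation (F9–F10). [folklore] -/
theorem hasFDerivAt_invMap {p : Fin 1 → ℝ} (hp : p 0 ≠ 0) :
    HasFDerivAt invMap (invMapDeriv p) p := by
  have h1 : HasFDerivAt (fun q : Fin 1 → ℝ => q 0) (ContinuousLinearMap.proj 0) p :=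
    hasFDerivAt_apply (𝕜 := ℝ) 0 p
  have h2 : HasFDerivAt (fun q : Fin 1 → ℝ => -(q 0)⁻¹)
      (-((-(p 0 ^ 2)⁻¹) • ContinuousLinearMap.proj (R := ℝ) (φ := fun _ : Fin 1 => ℝ) 0)) p :=
    ((hasDerivAt_inv hp).comp_hasFDerivAt p h1).neg
  rw [hasFDerivAt_pi']
  intro i
  have h3 : (ContinuousLinearMap.proj i).comp (invMapDeriv p) =
      -((-(p 0 ^ 2)⁻¹) • ContinuousLinearMap.proj (R := ℝ) (φ := fun _ : Fin 1 => ℝ) 0) := by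
    ext v
    simp [invMapDeriv, Fin.fin_one_eq_zero i]
  rw [h3]
  exact h2

/-- Auxiliary step of the isogeny / two-torsion computation (F9–F10). [folklore] -/
theorem det_invMapDeriv (p : Fin 1 → ℝ) : (invMapDeriv p).det = ((p 0) ^ 2)⁻¹ := by
  have h1 : ((invMapDeriv p : (Fin 1 → ℝ) →L[ℝ] (Fin 1 → ℝ)) : (Fin 1 → ℝ) →ₗ[ℝ] (Fin 1 → ℝ)) =
      ((p 0) ^ 2)⁻¹ • LinearMap.id := by
    ext x i; simp [invMapDeriv]
  unfold ContinuousLinearMap.det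
  rw [h1, LinearMap.det_smul, LinearMap.det_id, Module.finrank_fin_fun]
  simp

/-- Auxiliary step of the isogeny / two-torsion computation (F9–F10). [folklore] -/
theorem invMap_injOn : InjOn invMap {p : Fin 1 → ℝ | 1 < p 0} := by
  intro p _ q _ h
  have h0 : -(p 0)⁻¹ = -(q 0)⁻¹ := congr_fun h 0
  have h1 : p 0 = q 0 := inv_injective (neg_injective h0)
  funext i
  rw [Fin.fin_one_eq_zero i]; exact h1

/-- Auxiliary step of the isogeny / two-torsion computation (F9–F10). [folklore] -/
theorem invMap_image : invMap '' {p : Fin 1 → ℝ | 1 < p 0} = {p | -1 < p 0 ∧ p 0 < 0} := by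
  ext q
  simp only [mem_image, mem_setOf_eq]
  constructor
  · rintro ⟨p, hp, rfl⟩
    have hp0 : 0 < p 0 := by linarith
    refine ⟨?_, ?_⟩
    · show -1 < -(p 0)⁻¹
      have := inv_lt_one_of_one_lt₀ hp
      linarith
    · show -(p 0)⁻¹ < 0
      have := inv_pos.mpr hp0
      linarith
  · rintro ⟨h1, h0⟩
    refine ⟨fun _ => -(q 0)⁻¹, ?_, ?_⟩
    · show 1 < -(q 0)⁻¹
      rw [← inv_neg]
      exact (one_lt_inv₀ (by linarith)).mpr (by linarith)
    · funext i
      rw [Fin.fin_one_eq_zero i]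
      simp [invMap]

/-- Auxiliary step of the isogeny / two-torsion computation (F9–F10). [folklore] -/
theorem isSemialgebraicMapOn_invMap : IsSemialgebraicMapOn ℚ {p : Fin 1 → ℝ | 1 < p 0} invMap := by
  refine IsSemialgebraicMapOn.of_forall isSemialgebraic_Ioi_one fun j => ?_
  have hne : ∀ p ∈ {p : Fin 1 → ℝ | 1 < p 0}, MvPolynomial.aeval p (MvPolynomial.X 0 : MvPolynomial (Fin 1) ℚ) ≠ 0 := by
    intro p hp
    have hp : 1 < p 0 := hp
    simp only [MvPolynomial.aeval_X]
    linarith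
  refine (isSemialgebraicFunOn_aeval_div_aeval isSemialgebraic_Ioi_one (-1 : MvPolynomial (Fin 1) ℚ)
    (MvPolynomial.X 0) hne).congr fun p _ => ?_
  simp [invMap, neg_div]

/-- The Jacobian weight of `x ↦ −1/x` on `4x³ − 4x`: `1/√f(x) = (1/√f(−1/x))·x⁻²` for `x > 1`. [folklore] -/
theorem invMap_weight {v : ℝ} (hv : 1 < v) :
    1 / Real.sqrt (cubic 4 0 v) = 1 / Real.sqrt (cubic 4 0 (-v⁻¹)) * |(v ^ 2)⁻¹| := by
  have hv0 : 0 < v := by linarith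
  have hv2 : 0 < v ^ 2 := by positivity
  simp only [cubic, Rat.cast_ofNat, Rat.cast_zero, sub_zero, one_div]
  have hq : 4 * (-v⁻¹) ^ 3 - 4 * (-v⁻¹) = (4 * v ^ 3 - 4 * v) / (v ^ 2) ^ 2 := by
    field_simp
    ring
  rw [hq, Real.sqrt_div' _ (by positivity), Real.sqrt_sq hv2.le, abs_of_pos (inv_pos.mpr hv2)]
  have hpos : 0 < 4 * v ^ 3 - 4 * v := by nlinarith
  have hs : 0 < Real.sqrt (4 * v ^ 3 - 4 * v) := Real.sqrt_pos.mpr hpos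
  field_simp

/-- **(F10) Positive control**: `t₀` is literally ONE `KZ.changeOfVariablesRel` instance
(`Φ = −1/x` on the unbounded domain `(1,∞)`: `ℚ`-semialgebraic map, derivative within the domain,
injective, image exactly `σ`, weight exactly `1/√f`). [folklore] -/
theorem twoTorsionElem_mem_cov : twoTorsionElem ∈ KZ.changeOfVariablesRel := by
  refine ⟨1, genIoi, genσ40, invMap, invMapDeriv, isSemialgebraicMapOn_invMap,
    fun p hp => (hasFDerivAt_invMap ?_).hasFDerivWithinAt, invMap_injOn, ?_, fun p hp => ?_, rfl⟩
  · have hp : 1 < p 0 := hp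
    exact ne_of_gt (by linarith)
  · show σ₁ 4 0 = invMap '' {p : Fin 1 → ℝ | 1 < p 0}
    rw [σ₁_four_zero, invMap_image]
  · have hp : 1 < p 0 := hp
    rw [det_invMapDeriv]
    exact invMap_weight hp

/-- Hence `t₀ ∈ relations`. [folklore] -/
theorem twoTorsionElem_mem_relations : twoTorsionElem ∈ KZ.relations :=
  KZ.changeOfVariablesRel_subset_relations twoTorsionElem_mem_cov

/-- **(F10)** The `(4,0)` instance of the support item `TwoTorsionTransfer` (3413), for ARBITRARY
presentations `r, r'` of the two generators (the `EqOn` junk is absorbed by `equivalent_of_eqOn`). [folklore] -/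
theorem twoTorsionTransfer_four_zero (r r' : KZ.IntegralRep 1) (hr : r.domain = σ₃ 4 0)
    (hri : EqOn r.integrand (fun p => 1 / Real.sqrt (cubic 4 0 (p 0))) (σ₃ 4 0))
    (hr' : r'.domain = σ₁ 4 0)
    (hri' : EqOn r'.integrand (fun p => 1 / Real.sqrt (cubic 4 0 (p 0))) (σ₁ 4 0)) :
    KZ.Equivalent r r' := by
  have e1 : KZ.Equivalent r genIoi := by
    refine equivalent_of_eqOn ?_ ?_
    · show {p : Fin 1 → ℝ | 1 < p 0} = r.domain
      rw [hr, σ₃_four_zero]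
    · rw [hr]; intro p hp; rw [hri hp]; rfl
  have e2 : KZ.Equivalent genσ40 r' :=
    (equivalent_of_eqOn (by rw [hr']; rfl) (by rw [hr']; intro p hp; rw [hri' hp]; rfl)).symm
  exact e1.trans ((show KZ.Equivalent genIoi genσ40 from twoTorsionElem_mem_relations).trans e2)

end Summit.KontsevichZagierPeriods.RealEllipticSectorKernel.TwoTorsionElement

end
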